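import Mathlib.Analysis.SpecialFunctions.Trigonometric.InverseDeriv
import Mathlib.Analysis.SpecialFunctions.Sqrt
import Literature.Geometry.Lorentzian.KerrStarCoord
import Literature.Geometry.Lorentzian.KerrIngoingCoordMetric
import HarnessLib

/-!
# The Kerr metric in ingoing Kerr coordinates `(t*, r, μ, φ)`, II: the chart map and its Jacobian

Infrastructure (all results proved) for `Kerr.isRicciFlat M a r₀` (all spins). The map
`Ψ(t*, r, μ, φ) = (t*, Y_a(r, arccos μ, φ))`, `Y_a(r, θ, φ) = r n̂ + a sin θ φ̂` Kerr's ingoing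
spheroidal coordinates (`Kerr.kerrStar`, `KerrStarCoord.lean`; Kerr 1963; Visser arXiv:0706.0622,
§4), sends the coordinate domain `A = {max r₀ 0 < r, −1 < μ < 1}` (`Kerr.Ingoing.coordDomain`)
into the Kerr–Schild chart domain `Kerr.region a r₀`. We record

* `Kerr.Ingoing.chartFun`, `Kerr.Ingoing.chart` — the map (made total on `E4` by clamping the
  radial parameter; on `A` it is the honest chart) and its corestriction to `Kerr.region a r₀`;
* `Kerr.Ingoing.jac`, `Kerr.Ingoing.hasFDerivAt_chartFun`, `Kerr.Ingoing.contDiffAt_chartFun` — its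
  Jacobian `J_u v = v⁰ ∂_{t*} + (0, v¹ n⃗ + v² m⃗ + v³ p⃗)` with the explicit column vectors
  `n⃗ = ∂_r Y`, `m⃗ = ∂_μ Y`, `p⃗ = ∂_φ Y` (`jacN`, `jacM`, `jacP`), and smoothness on `A`.

The sequel `KerrIngoingCoordPullback.lean` computes the pulled-back Kerr–Schild form.

## References

* R. P. Kerr, Phys. Rev. Lett. 11 (1963) 237–238.
* M. Visser, *The Kerr spacetime: a brief introduction*, arXiv:0706.0622, §4, (33)–(36).
-/

noncomputable section

set_option maxSynthPendingDepth 3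

open Set Function Real
open scoped InnerProductSpace Topology

namespace Literature.Geometry.Lorentzian

namespace Kerr

namespace Ingoing

/-! ### The coordinate domain and the chart map -/

/-- The coordinate domain `A = {u | max r₀ 0 < r, −1 < μ < 1}` of the ingoing Kerr coordinates
(`r = u 1`, `μ = u 2`; `t* = u 0` and `φ = u 3` unrestricted). [cite: arXiv07060622, §4] -/
def coordDomain (r₀ : ℝ) : TopologicalSpace.Opens E4 :=
  ⟨{u | max r₀ 0 < u 1 ∧ -1 < u 2 ∧ u 2 < 1}, by
    refine (isOpen_lt continuous_const ((EuclideanSpace.proj (1 : Fin 4)).continuous)).inter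
      ((isOpen_lt continuous_const ((EuclideanSpace.proj (2 : Fin 4)).continuous)).inter
        (isOpen_lt ((EuclideanSpace.proj (2 : Fin 4)).continuous) continuous_const))⟩

variable {M a r₀ : ℝ} {u : E4}

/-- Membership in the coordinate domain. [folklore] -/
theorem mem_coordDomain : u ∈ coordDomain r₀ ↔ max r₀ 0 < u 1 ∧ -1 < u 2 ∧ u 2 < 1 := Iff.rfl

/-- On the coordinate domain `r > 0`. [folklore] -/
theorem radial_pos (hu : u ∈ coordDomain r₀) : 0 < u 1 := (le_max_right r₀ 0).trans_lt hu.1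

/-- On the coordinate domain `Σ = r² + a²μ² ≠ 0`. [folklore] -/
theorem sigma_ne_zero (hu : u ∈ coordDomain r₀) : sigma a u ≠ 0 := by
  have h := radial_pos hu
  unfold sigma; positivity

/-- On the coordinate domain `1 − μ² > 0`. [folklore] -/
theorem sinSq_pos (hu : u ∈ coordDomain r₀) : 0 < sinSq u := by
  have h1 := hu.2.1; have h2 := hu.2.2
  unfold sinSq; nlinarith

/-- On the coordinate domain `1 − μ² ≠ 0`. [folklore] -/
theorem sinSq_ne_zero (hu : u ∈ coordDomain r₀) : sinSq u ≠ 0 := (sinSq_pos hu).ne'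

/-- The clamped radial parameter: `r` itself above `max r₀ 0`, a fixed admissible value below (so
that the chart map is total with values in the chart domain; on the coordinate domain it is `r`).
[folklore] -/
def radialParam (r₀ ρ : ℝ) : ℝ := if max r₀ 0 < ρ then ρ else max r₀ 0 + 1

/-- Above `max r₀ 0` the radial parameter is `r`. [folklore] -/
theorem radialParam_of_lt {ρ : ℝ} (h : max r₀ 0 < ρ) : radialParam r₀ ρ = ρ := if_pos h

/-- The radial parameter always exceeds `max r₀ 0`. [folklore] -/
theorem lt_radialParam (r₀ ρ : ℝ) : max r₀ 0 < radialParam r₀ ρ := by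
  unfold radialParam; split_ifs with h
  · exact h
  · linarith

/-- The radial parameter is positive. [folklore] -/
theorem radialParam_pos (r₀ ρ : ℝ) : 0 < radialParam r₀ ρ :=
  (le_max_right r₀ 0).trans_lt (lt_radialParam r₀ ρ)

/-- **The chart map** `Ψ(t*, r, μ, φ) = (t*, Y_a(r, arccos μ, φ))` (radial parameter clamped off
the coordinate domain). Kerr 1963; Visser arXiv:0706.0622, §4. [cite: arXiv07060622, §4] -/
def chartFun (a r₀ : ℝ) (u : E4) : E4 :=
  E4.ofTimeSpace (u 0) (kerrStar a (radialParam r₀ (u 1)) (arccos (u 2)) (u 3))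

/-- Along the chart map the Kerr–Schild radius is the radial parameter. [cite: arXiv07060622, §4] -/
theorem radius_chartFun (a r₀ : ℝ) (u : E4) : radius a (chartFun a r₀ u) = radialParam r₀ (u 1) := by
  rw [chartFun, radius_ofTimeSpace, radius_kerrStar a (radialParam_pos r₀ _)]

/-- The chart map takes values in the chart domain `Kerr.region a r₀`. [cite: arXiv07060622, §4] -/
theorem chartFun_mem_region (a r₀ : ℝ) (u : E4) : chartFun a r₀ u ∈ region a r₀ := by
  rw [mem_region, radius_chartFun]
  exact lt_radialParam r₀ _

/-- **The chart** as a map into the Kerr chart domain `Kerr.region a r₀`. [cite: arXiv07060622, §4] -/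
def chart (a r₀ : ℝ) (u : E4) : region a r₀ := ⟨chartFun a r₀ u, chartFun_mem_region a r₀ u⟩

/-- `↑(chart u) = chartFun u`. [folklore] -/
@[simp]
theorem coe_chart (a r₀ : ℝ) (u : E4) : (chart a r₀ u : E4) = chartFun a r₀ u := rfl

/-- On the coordinate domain the chart map is the honest map `(t*, Y_a(r, arccos μ, φ))`. [folklore] -/
theorem chartFun_eq (hu : u ∈ coordDomain r₀) :
    chartFun a r₀ u = E4.ofTimeSpace (u 0) (kerrStar a (u 1) (arccos (u 2)) (u 3)) := by
  rw [chartFun, radialParam_of_lt hu.1]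

/-- The same, eventually near a point of the (open) coordinate domain. [folklore] -/
theorem chartFun_eventuallyEq (hu : u ∈ coordDomain r₀) :
    chartFun a r₀ =ᶠ[𝓝 u] fun u ↦ E4.ofTimeSpace (u 0) (kerrStar a (u 1) (arccos (u 2)) (u 3)) :=
  Filter.eventually_of_mem ((coordDomain r₀).isOpen.mem_nhds hu) fun _ hv ↦ chartFun_eq hv

/-! ### The trigonometry of `θ = arccos μ` -/

/-- `sin(arccos μ) = √(1 − μ²)`, abbreviated `s`. [folklore] -/
def sroot (u : E4) : ℝ := √(sinSq u)

/-- `s² = 1 − μ²`. [folklore] -/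
theorem sroot_sq (hu : u ∈ coordDomain r₀) : sroot u ^ 2 = sinSq u :=
  Real.sq_sqrt (sinSq_pos hu).le

/-- `s > 0` on the coordinate domain. [folklore] -/
theorem sroot_pos (hu : u ∈ coordDomain r₀) : 0 < sroot u := Real.sqrt_pos.2 (sinSq_pos hu)

/-- `sin(arccos μ) = s`. [folklore] -/
theorem sin_arccos_eq (u : E4) : sin (arccos (u 2)) = sroot u := by
  rw [sin_arccos, sroot, sinSq]

/-- `cos(arccos μ) = μ` on the coordinate domain. [folklore] -/
theorem cos_arccos_eq (hu : u ∈ coordDomain r₀) : cos (arccos (u 2)) = u 2 :=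
  cos_arccos hu.2.1.le hu.2.2.le

/-! ### The Jacobian columns -/

/-- `n⃗ = ∂_r Y = (cos φ s, sin φ s, μ)` — the radial unit vector `n̂(arccos μ, φ)`. [cite: arXiv07060622, §4] -/
def jacN (u : E4) : E3 := !₂[cos (u 3) * sroot u, sin (u 3) * sroot u, u 2]

/-- `m⃗ = ∂_μ Y = (−(μ/s)(r cos φ − a sin φ), −(μ/s)(r sin φ + a cos φ), r)`. [cite: arXiv07060622, §4] -/
def jacM (a : ℝ) (u : E4) : E3 :=
  !₂[-(u 2 / sroot u) * (u 1 * cos (u 3) - a * sin (u 3)),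
    -(u 2 / sroot u) * (u 1 * sin (u 3) + a * cos (u 3)), u 1]

/-- `p⃗ = ∂_φ Y = (−(r sin φ + a cos φ) s, (r cos φ − a sin φ) s, 0)`. [cite: arXiv07060622, §4] -/
def jacP (a : ℝ) (u : E4) : E3 :=
  !₂[-(u 1 * sin (u 3) + a * cos (u 3)) * sroot u, (u 1 * cos (u 3) - a * sin (u 3)) * sroot u, 0]

/-- **The Jacobian of the chart map** `J_u v = v⁰ ∂_{t*} + (0, v¹ n⃗ + v² m⃗ + v³ p⃗)`. [cite: arXiv07060622, §4] -/
def jac (a : ℝ) (u : E4) : E4 →L[ℝ] E4 :=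
  (E4.dx 0).smulRight (E4.basisVector 0) +
    E4.spaceEmbed.comp ((E4.dx 1).smulRight (jacN u) + (E4.dx 2).smulRight (jacM a u) +
      (E4.dx 3).smulRight (jacP a u))

/-- `J_u v = v⁰ ∂_{t*} + (0, v¹ n⃗ + v² m⃗ + v³ p⃗)`. [folklore] -/
theorem jac_apply (a : ℝ) (u v : E4) :
    jac a u v = E4.ofTimeSpace (v 0) (v 1 • jacN u + v 2 • jacM a u + v 3 • jacP a u) := by
  rw [E4.ofTimeSpace_eq_smul_add']
  simp only [jac, add_apply, ContinuousLinearMap.smulRight_apply, ContinuousLinearMap.comp_apply,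
    E4.dx, PiLp.proj_apply, map_add, map_smul]

/-- The time component of `J_u v` is `v⁰`. [folklore] -/
theorem jac_apply_zero (a : ℝ) (u v : E4) : jac a u v 0 = v 0 := by
  rw [jac_apply, E4.ofTimeSpace_apply_zero]

/-- The spatial part of `J_u v` is `v¹ n⃗ + v² m⃗ + v³ p⃗`. [folklore] -/
theorem spatial_jac (a : ℝ) (u v : E4) :
    E4.spatial (jac a u v) = v 1 • jacN u + v 2 • jacM a u + v 3 • jacP a u := by
  rw [jac_apply]; simp

/-! ### The chart map is differentiable on the coordinate domain, with Jacobian `J` -/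

/-- A map into `E3` has a Fréchet derivative iff its three components do. [folklore] -/
private theorem hasFDerivAt_e3_iff {f : E4 → E3} {f' : E4 →L[ℝ] E3} {x : E4} :
    HasFDerivAt f f' x ↔ ∀ i, HasFDerivAt (fun y ↦ f y i) ((EuclideanSpace.proj i).comp f') x := by
  rw [← hasFDerivWithinAt_univ, hasFDerivWithinAt_euclidean]
  simp only [hasFDerivWithinAt_univ]

/-- `∂(√(1 − μ²)) = −(μ/s) dμ` on the coordinate domain. [folklore] -/
theorem hasFDerivAt_sroot (hu : u ∈ coordDomain r₀) :
    HasFDerivAt sroot ((-(u 2 / sroot u)) • E4.dx 2) u := by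
  have hP : sinSq u ≠ 0 := sinSq_ne_zero hu
  have h := (Real.hasDerivAt_sqrt hP).comp_hasFDerivAt u (hasGrad_sinSq u)
  refine h.congr_fderiv ?_
  have hs : √(sinSq u) = sroot u := rfl
  ext v
  simp only [smul_apply, smul_eq_mul, zero_smul, zero_add, hs]
  field_simp

/-- **The chart map is Fréchet differentiable on the coordinate domain with derivative `J`.**
[cite: arXiv07060622, §4] -/
theorem hasFDerivAt_chartFun (hu : u ∈ coordDomain r₀) : HasFDerivAt (chartFun a r₀) (jac a u) u := by
  refine HasFDerivAt.congr_of_eventuallyEq ?_ (chartFun_eventuallyEq hu)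
  -- the honest map `u ↦ (u 0) • ∂₀ + spaceEmbed (Y u)`
  have hY : HasFDerivAt (fun u : E4 ↦ kerrStar a (u 1) (arccos (u 2)) (u 3))
      ((E4.dx 1).smulRight (jacN u) + (E4.dx 2).smulRight (jacM a u) +
        (E4.dx 3).smulRight (jacP a u)) u := by
    have h0 : HasFDerivAt (fun w : E4 ↦ w 0) (E4.dx 0) u := (E4.dx 0).hasFDerivAt
    have h1 : HasFDerivAt (fun w : E4 ↦ w 1) (E4.dx 1) u := (E4.dx 1).hasFDerivAt
    have h3 : HasFDerivAt (fun w : E4 ↦ w 3) (E4.dx 3) u := (E4.dx 3).hasFDerivAt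
    have hcos : HasFDerivAt (fun w : E4 ↦ cos (w 3)) ((-sin (u 3)) • E4.dx 3) u :=
      (Real.hasDerivAt_cos (u 3)).comp_hasFDerivAt (f := fun w : E4 ↦ w 3) u h3
    have hsin : HasFDerivAt (fun w : E4 ↦ sin (w 3)) (cos (u 3) • E4.dx 3) u :=
      (Real.hasDerivAt_sin (u 3)).comp_hasFDerivAt (f := fun w : E4 ↦ w 3) u h3
    have hs := hasFDerivAt_sroot hu
    have hμ : HasFDerivAt (fun w : E4 ↦ w 2) (E4.dx 2) u := (E4.dx 2).hasFDerivAt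
    have hc2 : ∀ᶠ w in 𝓝 u, cos (arccos (w 2)) = w 2 :=
      Filter.eventually_of_mem ((coordDomain r₀).isOpen.mem_nhds hu) fun _ hw ↦ cos_arccos_eq hw
    rw [hasFDerivAt_e3_iff]
    intro i
    fin_cases i
    · -- `x = (r cos φ − a sin φ) sin(arccos μ)`
      have hf : (fun y : E4 ↦ kerrStar a (y 1) (arccos (y 2)) (y 3) 0) =
          fun y ↦ (y 1 * cos (y 3) - a * sin (y 3)) * sroot y := by
        funext y; rw [kerrStar_apply_zero, sin_arccos_eq]
      simp only [Fin.zero_eta, Fin.isValue, hf]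
      have h := ((h1.mul hcos).sub (hsin.const_mul a)).mul hs
      refine h.congr_fderiv ?_
      ext v
      simp [jacN, jacM, jacP, E4.dx, mul_comm, mul_assoc, mul_left_comm]
      ring
    · -- `y = (r sin φ + a cos φ) sin(arccos μ)`
      have hf : (fun y : E4 ↦ kerrStar a (y 1) (arccos (y 2)) (y 3) 1) =
          fun y ↦ (y 1 * sin (y 3) + a * cos (y 3)) * sroot y := by
        funext y; rw [kerrStar_apply_one, sin_arccos_eq]
      simp only [Fin.mk_one, Fin.isValue, hf]
      have h := ((h1.mul hsin).add (hcos.const_mul a)).mul hs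
      refine h.congr_fderiv ?_
      ext v
      simp [jacN, jacM, jacP, E4.dx, mul_comm, mul_assoc, mul_left_comm]
      ring
    · -- `z = r cos(arccos μ) = r μ` near `u`
      have hf : (fun y : E4 ↦ kerrStar a (y 1) (arccos (y 2)) (y 3) 2) =ᶠ[𝓝 u]
          fun y ↦ y 1 * y 2 := by
        filter_upwards [hc2] with y hy
        rw [kerrStar_apply_two, hy]
      simp only [Fin.reduceFinMk, Fin.isValue]
      refine HasFDerivAt.congr_of_eventuallyEq ?_ hf
      have h := h1.mul hμ
      refine h.congr_fderiv ?_
      ext v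
      simp [jacN, jacM, jacP, E4.dx]
      ring
  have h0 : HasFDerivAt (fun w : E4 ↦ w 0) (E4.dx 0) u := (E4.dx 0).hasFDerivAt
  have h := (h0.smul_const (E4.basisVector 0)).add (E4.spaceEmbed.hasFDerivAt.comp u hY)
  have heq : (fun u : E4 ↦ E4.ofTimeSpace (u 0) (kerrStar a (u 1) (arccos (u 2)) (u 3))) =
      fun u : E4 ↦ (u 0) • E4.basisVector 0 + E4.spaceEmbed (kerrStar a (u 1) (arccos (u 2)) (u 3)) := by
    funext u; exact E4.ofTimeSpace_eq_smul_add' _ _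
  rw [heq]
  refine h.congr_fderiv ?_
  ext v i
  simp [jac]

/-- **The chart map is `C^∞` on the coordinate domain** (`arccos` is smooth on `(−1, 1)`).
[cite: arXiv07060622, §4] -/
theorem contDiffAt_chartFun (hu : u ∈ coordDomain r₀) {n : WithTop ℕ∞} :
    ContDiffAt ℝ n (chartFun a r₀) u := by
  refine ContDiffAt.congr_of_eventuallyEq ?_ (chartFun_eventuallyEq hu)
  have hc : ∀ i, ContDiff ℝ n fun w : E4 ↦ w i := contDiff_euclidean.1 contDiff_id
  have h0 := hc 0
  have h1 := hc 1
  have h2 := hc 2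
  have h3 := hc 3
  have hθ : ContDiffAt ℝ n (arccos ∘ fun w : E4 ↦ w 2) u :=
    (contDiffAt_arccos hu.2.1.ne' hu.2.2.ne).comp u h2.contDiffAt
  have hsθ : ContDiffAt ℝ n (sin ∘ arccos ∘ fun w : E4 ↦ w 2) u := contDiff_sin.contDiffAt.comp u hθ
  have hcθ : ContDiffAt ℝ n (cos ∘ arccos ∘ fun w : E4 ↦ w 2) u := contDiff_cos.contDiffAt.comp u hθ
  have hcφ : ContDiff ℝ n (fun w : E4 ↦ cos (w 3)) := contDiff_cos.comp h3
  have hsφ : ContDiff ℝ n (fun w : E4 ↦ sin (w 3)) := contDiff_sin.comp h3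
  rw [contDiffAt_euclidean]
  intro i
  refine Fin.cases ?_ (fun j ↦ ?_) i
  · simp only [Fin.isValue, E4.ofTimeSpace_apply_zero]
    exact h0.contDiffAt
  · simp only [E4.ofTimeSpace_apply_succ]
    fin_cases j
    · simp only [Fin.zero_eta, Fin.isValue, kerrStar_apply_zero]
      exact ((h1.contDiffAt.mul hcφ.contDiffAt).sub (hsφ.contDiffAt.const_smul a) |>.mul hsθ).congr_of_eventuallyEq
        (Filter.Eventually.of_forall fun w ↦ by simp [smul_eq_mul])
    · simp only [Fin.mk_one, Fin.isValue, kerrStar_apply_one]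
      exact ((h1.contDiffAt.mul hsφ.contDiffAt).add (hcφ.contDiffAt.const_smul a) |>.mul hsθ).congr_of_eventuallyEq
        (Filter.Eventually.of_forall fun w ↦ by simp [smul_eq_mul])
    · simp only [Fin.reduceFinMk, Fin.isValue, kerrStar_apply_two]
      exact h1.contDiffAt.mul hcθ

/-- The chart map is differentiable on the coordinate domain. [folklore] -/
theorem differentiableAt_chartFun (hu : u ∈ coordDomain r₀) : DifferentiableAt ℝ (chartFun a r₀) u :=
  (hasFDerivAt_chartFun hu).differentiableAt

/-- Its Fréchet derivative there is `J`. [folklore] -/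
theorem fderiv_chartFun (hu : u ∈ coordDomain r₀) : fderiv ℝ (chartFun a r₀) u = jac a u :=
  (hasFDerivAt_chartFun hu).fderiv

end Ingoing

end Kerr

end Literature.Geometry.Lorentzian

end
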